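import Summits.BirchSwinnertonDyer.BirchSwinnertonDyer.Theorems.SchneiderFreeAdditiveX3GaloisCharacterConductor
import Summits.BirchSwinnertonDyer.BirchSwinnertonDyer.Theorems.SchneiderFreeAdditiveX3GordCellSliverScope
import Literature.NumberTheory.EllipticCurves.HeegnerHypothesisKroneckerProofs
import Literature.NumberTheory.EllipticCurves.ModularityVersionApProofs
import Literature.NumberTheory.GaloisRepresentations.IntegralGaloisActionProofs
import Literature.NumberTheory.EllipticCurves.OpenImageMazurProofs
import HarnessLib

/-!
# Route `SchneiderFreeAdditiveX3` (K1 door), crux r3 `GordTwoBranchIMC` (item 19177): the `d_K = −3` sliver is VOID AT `p = 13` —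
# no elliptic curve over `ℚ` with a rational 13-isogeny has all its primes of bad reduction `≡ 1 (mod 3)`

Cell `bsd-schneider-ideate`, seat `bsd-schneider-door-c5` (prover, generation 34; `--supports` 19177).  PARTITION: board row B6 ∩ X3 ∩
sst-twist, `r = 1`, (G-ord, `e = 2`) half (census: 2 pairs at `p = 13`, both with even conductor) — ASSEMBLY support; types-the-object-of
nothing; closes nothing (BSD NOT advanced).  bears_on: K1-door (item 19177, registered stub `stub_sliver` = `KYReadSliver`).

WHY.  A socket datum of the sliver at `(W, p)` consists of an imaginary quadratic `K` with `d_K = −3` satisfying the Heegner hypothesis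
for `N_W` — so EVERY bad prime of `W` splits in `ℚ(√−3)`, i.e. is `≡ 1 (mod 3)` — and a curve `W` of the reducible row (`Red W p`: a
rational `p`-isogeny).  Generation 34's `…GordCellSliverScope` placed `p` in `{7, 13, 19, 37, 43, 67, 163}` and exhibited a genuine datum at
`p = 7`.  THIS FILE shows that `p = 13` carries NO datum, by an arithmetic obstruction in the style of Mazur 1978 §§5–6:

**Theorem** (`hasIrreducibleModPGaloisRep_thirteen_of_forall_bad_mod_three`).  If `E/ℚ` (globally minimal model) has all its primes
of bad reduction `≡ 1 (mod 3)`, then `E[13]` is irreducible.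
*Proof.*  Let `r : Γ_ℚ → 𝔽₁₃ˣ` be the isogeny character of a stable line.  It is unramified at every good prime `≠ 13`
(`isogenyCharacter_eq_one_of_mem_inertia`), hence outside the set `S` of primes `≡ 1 (mod 3)` (which contains `13`); its values are
killed by `12`, prime to every `ℓ ∈ S`.  By conductor-supported Kronecker–Weber (`GaloisCharacterConductor.exists_squarefree_level_of_
unramified_outside`) `r = β ∘ χ_m` with `m` squarefree, all prime factors `≡ 1 (mod 3)`; in particular `2, 3 ∤ m`.  At an arithmetic
Frobenius `φ` above `3` (a good prime): `χ_m(φ) = 3`, so `r(φ) = β(3)`; and `−3` is a square mod `m`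
(`isSquare_neg_three_zmod_of_squarefree`), `−3 ≡ z²`, so `3 = −z²` in `(ℤ/m)ˣ` and `r(φ)⁶ = β(3)⁶ = β(z)¹² = 1` (`𝔽₁₃ˣ` has exponent
`12`).  On the other hand Mazur's Prop. 6.3 (1) with Hasse (`exists_trace_congruences_of_hasGoodReductionAtPrime`) gives
`r(φ) + 3 r(φ)⁻¹ = a₃(E)`, `a₃² ≤ 12`; the twelve-element check `pow_six_eq_neg_one_of_trace_three` shows every solution
`x ∈ 𝔽₁₃ˣ` of `x + 3/x ∈ {−3,…,3}` (namely `x ∈ {2, 5, 6, 7, 8, 11}`, of order `4` or `12`) has `x⁶ = −1`.  Contradiction. ∎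

* §1 `pow_six_eq_neg_one_of_trace_three` — the finite check in `𝔽₁₃ˣ`.
* §2 the theorem above.
* §3 `hasIrreducibleModPGaloisRep_thirteen_of_heegner_of_discr_eq_neg_three` — for `K` imaginary quadratic with `d_K = −3` satisfying the
  Heegner hypothesis for `N_W`: `W[13]` is irreducible (every `ℓ ∣ N_W` splits in `K`: `ℓ = 2` would need `d_K ≡ 1 (mod 8)`, odd `ℓ` has
  `(−3/ℓ) = 1`, so `ℓ ≥ 7` and `ℓ ≡ 1 (mod 6)`).  Hence the sliver `KYReadSliver` has NO socket datum at `p = 13` on the reducible row.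
* §4 `mem_sliverPrimes_of_heegner_of_red_of_discr_eq_neg_three` — generation 34's support lemma refined: at a socket datum with `d_K = −3`,
  the Heegner hypothesis for `N_W` and `Red W p`, `p ∈ {7, 19, 37, 43, 67, 163}` (displayed published fact: Mazur's
  `mazur_isogeny_irreducible`; on paper the four CM primes and `37` are excluded by Mazur's `j`-table, not typed in the tree — leaving `7`,
  where `…GordCellSliverScope` §4 / kit j334044 exhibit data).

HONEST FRAMING: §1–§3 are UNCONDITIONAL theorems (inputs: the tree's proved Kronecker–Weber, inertia and Frobenius machinery of
`OpenImageMazur*Proofs`, Hasse); §4 is conditional on the displayed published fact `mazur_isogeny_irreducible`.  No definition, no new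
named fact, no `sorry`.  Nothing here advances BSD; the crux 19177 stays OPEN; «closes rung: none».
References: Mazur, Invent. Math. 44 (1978) §5 Lemma 5.2, §6 Prop. 6.3 (1), Cor. 6.1 [Mazur1978]; Washington, *Cyclotomic Fields*, Thm. 14.1
[Washington1997]; Hardy–Wright Thm. 96 [HardyWright2008]; Silverman AEC V.1.1 (Hasse) [SilvermanAEC2009]; Darmon 2004 Hyp. 3.9 [Darmon2004].
-/

set_option autoImplicit false
-- `Summit.<P>.<Sub>` repeats `BirchSwinnertonDyer` by the tree's layout convention (D-0017)
set_option linter.dupNamespace false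

noncomputable section

open scoped Classical NumberField

open NumberField IsDedekindDomain IsDedekindDomain.HeightOneSpectrum Field WeierstrassCurve
  Literature.NumberTheory.GaloisRepresentations Literature.NumberTheory.EllipticCurves
  Literature.NumberTheory.EllipticCurves.Rank1Residual
  Summit.BirchSwinnertonDyer.BirchSwinnertonDyer.Theorems.SchneiderFree

namespace Summit.BirchSwinnertonDyer.BirchSwinnertonDyer.Theorems.SchneiderFreeAdditiveX3.KYBranchSliverVoidThirteen

/-! ### §1 The finite check in `𝔽₁₃ˣ` -/

/-- **Mazur's congruence at `ℓ = 3` pins `r(φ₃)⁶ = −1` in `𝔽₁₃ˣ`.**  If `x ∈ 𝔽₁₃ˣ` and `x + 3x⁻¹ = t` for an integer `t` with `t² ≤ 12`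
(Hasse at `3`), then `x ∈ {2, 5, 6, 7, 8, 11}` — of order `4` or `12` — and `x⁶ = −1`.  Kernel check over the twelve units and the seven
traces. [cite: Mazur1978, §6 Prop. 6.3 (1) and Cor. 6.1 (p. 153)] -/
theorem pow_six_eq_neg_one_of_trace_three (x : (ZMod 13)ˣ) (t : ℤ) (ht : t ^ 2 ≤ 4 * 3)
    (h : (x : ZMod 13) + ((3 : ℕ) : ZMod 13) * ((x⁻¹ : (ZMod 13)ˣ) : ZMod 13) = t) : x ^ 6 = -1 := by
  have h1 : -3 ≤ t := by nlinarith
  have h2 : t ≤ 3 := by nlinarith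
  rw [Nat.cast_ofNat] at h
  interval_cases t <;> revert x <;> decide

/-- `−1 ≠ 1` in `𝔽₁₃ˣ`. [folklore] -/
theorem neg_one_ne_one_units_zmod_thirteen : (-1 : (ZMod 13)ˣ) ≠ 1 := by decide

/-! ### §2 No rational 13-isogeny when every bad prime is `≡ 1 (mod 3)` -/

/-- **No elliptic curve over `ℚ` with a rational 13-isogeny has all its primes of bad reduction `≡ 1 (mod 3)`** (equivalently: if every
bad prime of the globally minimal `E/ℚ` is `≡ 1 (mod 3)`, then `E[13]` is an irreducible `Γ_ℚ`-module).  Proof in the module docstring: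
isogeny character `r` unramified outside the primes `≡ 1 (mod 3)` ⟹ `r = β ∘ χ_m`, `m` squarefree with such prime factors
(conductor-supported Kronecker–Weber); `−3` is a square mod `m` ⟹ `r(φ₃)⁶ = β(3)⁶ = 1`; Mazur's Prop. 6.3 (1) + Hasse at the good prime
`3` ⟹ `r(φ₃)⁶ = −1` (§1).  UNCONDITIONAL. [cite: Mazur1978, §5 Lemma 5.2 and §6 Prop. 6.3 (1) (pp. 149, 153)]
[cite: Washington1997, Thm. 14.1] [cite: HardyWright2008, Thm 96] -/
theorem hasIrreducibleModPGaloisRep_thirteen_of_forall_bad_mod_three (W : WeierstrassCurve ℚ) [W.IsElliptic] [W.IsGloballyMinimal]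
    (hbad : ∀ (ℓ : ℕ) [Fact ℓ.Prime], ¬ W.HasGoodReductionAtPrime ℓ → ℓ % 3 = 1) :
    W.HasIrreducibleModPGaloisRep 13 := by
  by_contra hred
  haveI h13 : Fact (Nat.Prime 13) := ⟨by norm_num⟩
  haveI : NeZero ((13 : ℕ) : ℚ) := ⟨by norm_num⟩
  -- a stable line `⟨P⟩ ⊂ E[13]` and its isogeny character `r`
  obtain ⟨H, hH, hcard⟩ := (Mazur1978.not_hasIrreducibleModPGaloisRep_iff_exists_natCard_eq W 13).mp hred
  obtain ⟨P, hP0, rfl⟩ := Mazur1978.exists_eq_zmultiples_of_natCard_eq W 13 hcard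
  have hst : ∀ σ : absoluteGaloisGroup ℚ, σ • P ∈ AddSubgroup.zmultiples P :=
    fun σ => hH σ P (AddSubgroup.mem_zmultiples P)
  obtain ⟨r, hr⟩ := Mazur1978.exists_isogenyCharacter W 13 hP0 hst
  have hker := Mazur1978.isOpen_ker_of_smul_eq W 13 hP0 hr
  have h12 : ∀ σ : absoluteGaloisGroup ℚ, r σ ^ 12 = 1 := fun σ => ZMod.units_pow_card_sub_one_eq_one 13 (r σ)
  -- good reduction at every prime `≢ 1 (mod 3)`
  have hgood : ∀ (ℓ : ℕ) [Fact ℓ.Prime], ℓ % 3 ≠ 1 → W.HasGoodReductionAtPrime ℓ := by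
    intro ℓ _ hℓ
    by_contra hng
    exact hℓ (hbad ℓ hng)
  -- `r` is unramified outside the primes `≡ 1 (mod 3)`
  set S : Set ℕ := {p | p.Prime ∧ p % 3 = 1} with hSdef
  have hS : ∀ p ∈ S, p.Coprime 12 := by
    intro p hpS
    obtain ⟨hp, hpS'⟩ := hpS
    refine (Nat.Prime.coprime_iff_not_dvd hp).mpr fun hdvd => ?_
    rw [show (12 : ℕ) = 2 ^ 2 * 3 by norm_num] at hdvd
    rcases (Nat.Prime.dvd_mul hp).mp hdvd with h | h
    · have := (Nat.prime_dvd_prime_iff_eq hp Nat.prime_two).mp (hp.dvd_of_dvd_pow h); omega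
    · have := (Nat.prime_dvd_prime_iff_eq hp Nat.prime_three).mp h; omega
  have hunr : ∀ p : ℕ, p.Prime → p ∉ S → ∀ (v : HeightOneSpectrum (𝓞 ℚ)), Rat.HeightOneSpectrum.natGenerator v = p →
      ∀ 𝔓 ∈ v.primesAbove, ∀ τ ∈ 𝔓.inertia (absoluteGaloisGroup ℚ), r τ = 1 := by
    intro p hp hpS v hgen 𝔓 h𝔓 τ hτ
    haveI := Fact.mk hp
    have hpS' : p % 3 ≠ 1 := fun h => hpS ⟨hp, h⟩
    -- good reduction at the place `v` (over `p`)
    have hgoodv : W.HasGoodReductionAt v := by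
      haveI hF := Fact.mk (Rat.HeightOneSpectrum.primesEquiv v).2
      refine (hasGoodReductionAtPrime_iff_hasGoodReductionAt_ringOfIntegers v W).mp ?_
      have hq : ((Rat.HeightOneSpectrum.primesEquiv v : Nat.Primes) : ℕ) % 3 ≠ 1 := by
        change Rat.HeightOneSpectrum.natGenerator v % 3 ≠ 1
        rw [hgen]; exact hpS'
      exact hgood _ hq
    -- `13 ∉ v`: the prime under `v` is `p ≠ 13`
    have hNv : ((13 : ℕ) : 𝓞 ℚ) ∉ v.asIdeal := by
      intro hmem
      have h1 : ((Rat.HeightOneSpectrum.primesEquiv v : Nat.Primes) : ℕ) = 13 := primesEquiv_eq_of_natCast_mem h13.out hmem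
      have h2 : ((Rat.HeightOneSpectrum.primesEquiv v : Nat.Primes) : ℕ) = p := hgen
      exact hpS' (by rw [← h2, h1])
    exact Mazur1978.isogenyCharacter_eq_one_of_mem_inertia W 13 hP0 hr hgoodv hNv h𝔓 hτ
  -- conductor-supported Kronecker–Weber: `r = β ∘ χ_m`, `m` squarefree with prime factors `≡ 1 (mod 3)`
  obtain ⟨m, hm, β, hsq, hprimes, hβ⟩ :=
    GaloisCharacterConductor.exists_squarefree_level_of_unramified_outside r hker h12 S hS hunr
  have hprimes' : ∀ q : ℕ, q.Prime → q ∣ m → q % 3 = 1 := fun q hq hqm => (hprimes q hq hqm).2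
  have h3m : ¬ 3 ∣ m := fun h => by have := hprimes' 3 Nat.prime_three h; omega
  -- an arithmetic Frobenius above `3`
  set v₃ : HeightOneSpectrum (𝓞 ℚ) := Rat.HeightOneSpectrum.primesEquiv.symm ⟨3, Nat.prime_three⟩ with hv₃def
  have hgen₃ : Rat.HeightOneSpectrum.natGenerator v₃ = 3 := by
    change ((Rat.HeightOneSpectrum.primesEquiv v₃ : Nat.Primes) : ℕ) = 3
    rw [hv₃def, Equiv.apply_symm_apply]
  have hv₃ : ((3 : ℕ) : 𝓞 ℚ) ∈ v₃.asIdeal := by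
    have h := Mazur1978.natCast_natGenerator_mem_asIdeal v₃
    rwa [hgen₃] at h
  obtain ⟨𝔓, h𝔓⟩ := HeightOneSpectrum.primesAbove_nonempty v₃
  obtain ⟨φ, hφ⟩ := exists_isArithFrobAt_of_mem_primesAbove_holds (K := ℚ) (v := v₃) h𝔓
  -- Mazur's Prop. 6.3 (1) at the good prime `3`, with Hasse: `r(φ)⁶ = −1`
  have hgood3 : W.HasGoodReductionAtPrime 3 := hgood 3 (by norm_num)
  obtain ⟨t, ht, hsum, -⟩ :=
    Mazur1978.exists_trace_congruences_of_hasGoodReductionAtPrime W 13 3 (by norm_num) hgood3 hP0 hr hv₃ h𝔓 hφ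
  have hneg : r φ ^ 6 = -1 := pow_six_eq_neg_one_of_trace_three (r φ) t ht hsum
  -- `χ_m(φ) = 3` and `−3` is a square mod `m`: `r(φ)⁶ = 1`
  have hχ : ((modNCyclotomicCharacter ℚ m φ : (ZMod m)ˣ) : ZMod m) = (3 : ℕ) :=
    Literature.NumberTheory.GaloisRepresentations.Rat.modNCyclotomicCharacter_of_isArithFrobAt Nat.prime_three h3m hv₃ h𝔓 hφ
  obtain ⟨z, hz⟩ := GaloisCharacterConductor.isSquare_neg_three_zmod_of_squarefree m hsq hprimes'
  set tu : (ZMod m)ˣ := modNCyclotomicCharacter ℚ m φ with htudef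
  have hzz : z * z = -(tu : ZMod m) := by rw [hχ, Nat.cast_ofNat, ← hz]
  have hzunit : IsUnit z := by
    have h : IsUnit (z * z) := by rw [hzz]; exact tu.isUnit.neg
    exact (IsUnit.mul_iff.mp h).1
  set zu : (ZMod m)ˣ := hzunit.unit with hzudef
  have hzu : (zu : ZMod m) = z := hzunit.unit_spec
  have htu : tu = -(zu * zu) := by
    ext
    rw [Units.val_neg, Units.val_mul, hzu, hzz, neg_neg]
  have hpos : r φ ^ 6 = 1 := by
    have htu6 : tu ^ 6 = zu ^ (6 + 6) := by
      rw [htu, Even.neg_pow ⟨3, rfl⟩, mul_pow, ← pow_add]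
    rw [← hβ φ, ← map_pow, htu6, map_pow]
    exact ZMod.units_pow_card_sub_one_eq_one 13 (β zu)
  exact absurd (hneg.symm.trans hpos) neg_one_ne_one_units_zmod_thirteen

/-! ### §3 The sliver has no socket datum at `p = 13` -/

/-- `(−3/3) = 0` (the prime `3` ramifies in `ℚ(√−3)`). [folklore] -/
theorem legendreSym_three_neg_three : legendreSym 3 (-3) = 0 :=
  (legendreSym.eq_zero_iff 3 (-3)).mpr (by decide)

/-- **Under the Heegner hypothesis for `N_W` in an imaginary quadratic `K` with `d_K = −3`, every bad prime of `W` is `≡ 1 (mod 3)`**: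
a bad prime `ℓ` divides `N_W` (`dvd_conductorNorm_iff_not_hasGoodReductionAtPrime`), so it splits in `K`; `ℓ = 2` would force
`d_K ≡ 1 (mod 8)`, and for odd `ℓ` `(−3/ℓ) = 1` forces `ℓ ≠ 3` and `ℓ ≡ 1 (mod 6)` (Hardy–Wright Thm. 96).
[cite: Darmon2004, Hypothesis 3.9] [cite: HardyWright2008, Thm 96] -/
theorem mod_three_eq_one_of_bad_of_heegner_of_discr_eq_neg_three {K : Type} [Field K] [NumberField K] (hK : IsImaginaryQuadratic K)
    (hd : NumberField.discr K = -3) (W : WeierstrassCurve ℚ) [W.IsElliptic] {N : ℕ} (hN : W.conductorNorm ℤ = N)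
    (hHe : SatisfiesHeegnerHypothesis N K) (ℓ : ℕ) [hℓ : Fact ℓ.Prime] (hbad : ¬ W.HasGoodReductionAtPrime ℓ) : ℓ % 3 = 1 := by
  have hℓN : ℓ ∣ N := hN ▸ (W.dvd_conductorNorm_iff_not_hasGoodReductionAtPrime ℓ).mpr hbad
  obtain ⟨h2, hodd⟩ := (satisfiesHeegnerHypothesis_iff_kronecker N K hK.1).mp hHe ℓ hℓ.out hℓN
  by_cases hℓ2 : ℓ = 2
  · have h8 := h2 hℓ2
    rw [hd] at h8
    omega
  · have hj := hodd hℓ2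
    rw [hd, ← jacobiSym.legendreSym.to_jacobiSym] at hj
    have hℓ3 : ℓ ≠ 3 := by
      rintro rfl
      exact zero_ne_one (legendreSym_three_neg_three.symm.trans hj)
    have hgt : 3 < ℓ := by
      have := hℓ.out.two_le
      have h4 : ℓ ≠ 4 := by rintro rfl; exact absurd hℓ.out (by norm_num)
      omega
    have h0 : ((-3 : ℤ) : ZMod ℓ) ≠ 0 := by
      intro h
      have hdvd : (ℓ : ℤ) ∣ -3 := (ZMod.intCast_zmod_eq_zero_iff_dvd (-3) ℓ).mp h
      have hdvd' : ℓ ∣ 3 := by exact_mod_cast Int.dvd_neg.mp hdvd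
      exact absurd (Nat.le_of_dvd (by norm_num) hdvd') (by omega)
    have hsq : IsSquare ((-3 : ℤ) : ZMod ℓ) := (legendreSym.eq_one_iff ℓ h0).mp hj
    have hsq' : IsSquare (-3 : ZMod ℓ) := by simpa using hsq
    have h6 := (Literature.NumberTheory.Congruences.SmallQuadraticResidues.isSquare_neg_three_iff hgt).mp hsq'
    omega

/-- **The `d_K = −3` sliver has NO socket datum at `p = 13` on the reducible row.**  If `K` is imaginary quadratic with `d_K = −3` and
satisfies the Heegner hypothesis for the conductor of the globally minimal `W/ℚ`, then `W[13]` is IRREDUCIBLE (`¬ Red W 13`): every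
bad prime of `W` is `≡ 1 (mod 3)` (previous lemma) and §2 applies.  So the bundled input `KYReadSliver` of crux r3's record is vacuous at
`p = 13` for every `W` of class X3 (which has `Red W 13`); with generation 34's `…GordCellSliverScope` §3 its support is `{7, 19, 37, 43,
67, 163}` under Mazur's theorem (§4).  UNCONDITIONAL; nothing asserted about BSD. [cite: Mazur1978, §5 Lemma 5.2 and §6 Prop. 6.3 (1)]
[cite: Darmon2004, Hypothesis 3.9] -/
theorem hasIrreducibleModPGaloisRep_thirteen_of_heegner_of_discr_eq_neg_three {K : Type} [Field K] [NumberField K]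
    (hK : IsImaginaryQuadratic K) (hd : NumberField.discr K = -3) (W : WeierstrassCurve ℚ) [W.IsElliptic] [W.IsGloballyMinimal]
    {N : ℕ} (hN : W.conductorNorm ℤ = N) (hHe : SatisfiesHeegnerHypothesis N K) : W.HasIrreducibleModPGaloisRep 13 :=
  hasIrreducibleModPGaloisRep_thirteen_of_forall_bad_mod_three W fun ℓ _ hbad =>
    mod_three_eq_one_of_bad_of_heegner_of_discr_eq_neg_three hK hd W hN hHe ℓ hbad

/-! ### §4 The sliver's support refined: `p ∈ {7, 19, 37, 43, 67, 163}` (Mazur) -/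

/-- **Support of the `d_K = −3` sliver, refined.**  At a socket datum of `KYReadSliver` on the reducible row — `K` imaginary quadratic with
`d_K = −3`, `p ∤ #𝓞_K^×`, a degree-one prime `𝔭 ∋ p`, the Heegner hypothesis for `N_W`, and `Red W p` — one has `p ∈ {7, 19, 37, 43, 67,
163}`: generation 34's `KYBranchSliverScope.mem_sliverPrimes_of_red_of_discr_eq_neg_three` (door-c3's `p ≡ 1 (mod 3)` + Mazur's
`mazur_isogeny_irreducible`, DISPLAYED as a hypothesis) minus `13` (§3).  On paper Mazur's `j`-table removes the four CM primes and `37`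
as well (not typed in the tree); `7` carries data (kit j334044).  CONDITIONAL on the displayed published fact.
[cite: Mazur1978, Thm 1] [cite: HardyWright2008, Thm 96] -/
theorem mem_sliverPrimes_of_heegner_of_red_of_discr_eq_neg_three (hM : mazur_isogeny_irreducible)
    {K : Type} [Field K] [NumberField K] (hK : IsImaginaryQuadratic K) (hd : NumberField.discr K = -3)
    {p : ℕ} [Fact p.Prime] (hunit : ¬ p ∣ Units.torsionOrder K) {𝔭 : HeightOneSpectrum (𝓞 K)}
    (h𝔭 : ((p : ℕ) : 𝓞 K) ∈ 𝔭.asIdeal) (he : 𝔭.asIdeal.ramificationIdx (𝓞 ℚ) = 1) (hf : 𝔭.asIdeal.inertiaDeg (𝓞 ℚ) = 1)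
    (W : WeierstrassCurve ℚ) [W.IsElliptic] [W.IsGloballyMinimal] (hred : Red W p)
    {N : ℕ} (hN : W.conductorNorm ℤ = N) (hHe : SatisfiesHeegnerHypothesis N K) :
    p ∈ ({7, 19, 37, 43, 67, 163} : Finset ℕ) := by
  have h7 := KYBranchSliverScope.mem_sliverPrimes_of_red_of_discr_eq_neg_three hM hK hd hunit h𝔭 he hf W hred
  have h13 : p ≠ 13 := by
    rintro rfl
    exact hred (hasIrreducibleModPGaloisRep_thirteen_of_heegner_of_discr_eq_neg_three hK hd W hN hHe)
  simp only [Finset.mem_insert, Finset.mem_singleton] at h7 ⊢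
  omega

end Summit.BirchSwinnertonDyer.BirchSwinnertonDyer.Theorems.SchneiderFreeAdditiveX3.KYBranchSliverVoidThirteen

end
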